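import Literature.Barriers.CriticalPhenomena.RigorousRGSmallParameterKatoFormula
import Literature.Barriers.CriticalPhenomena.RigorousRGSmallParameter
import HarnessLib

/-!
# `RigorousRGSmallParameter` (Slade, Theorem 1.4.1): Proposition 2.1.3 PROVED — the resolvent of
# the fractional Laplacian as a mixture of Laplacian resolvents,
# `((-Δ)^β + m²)⁻¹ = ∫₀^∞ (-Δ + s)⁻¹ ρ^{(β)}(s, m²) ds`

Companion of `RigorousRGSmallParameterKatoFormula.lean` (Lemma 2.1.2, Kato's formula, proved) in
the proof architecture of the barrier `RigorousRGSmallParameter.lean`. Source: G. Slade, *Critical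
exponents for long-range `O(n)` models below the upper critical dimension*, CMP 358 (2018),
arXiv:1611.06169, §2.1.2: the Fourier-integral resolvents (2.12)
`(-Δ+m²)⁻¹_{0,x} = (2π)^{-d}∫_{[-π,π]^d} e^{ik·x}/(λ(k)+m²) dk` and (2.13)
`((-Δ)^β+m²)⁻¹_{0,x} = (2π)^{-d}∫_{[-π,π]^d} e^{ik·x}/(λ(k)^β+m²) dk`, and **Proposition 2.1.3**:
"For `d ≥ 1`, if `m² > 0` and `β ∈ (0,1)`, or if `m² = 0` and `β ∈ (0, 1 ∧ d/2)`, then (2.17)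
`((-Δ)^β+m²)⁻¹_{0,x} = ∫₀^∞ (-Δ+s)⁻¹_{0,x} ρ^{(β)}(s,m²) ds`." Printed proof: "Note that the
right-hand side of (2.17) only involves `s > 0`, for which `(-Δ+s)⁻¹` is well-defined in all
dimensions. By (2.13) and Lemma 2.1.2, `((-Δ)^β+m²)⁻¹_{0,x} = (2π)^{-d}∫dk e^{ik·x}∫₀^∞ ds
ρ^{(β)}(s,m²)/(λ(k)+s)`. Then we apply Fubini's Theorem and (2.12) to obtain (2.17)." This is the
"essential" device (the paper's words before Lemma 2.1.2) by which the finite-range decomposition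
and all covariance bounds for the fractional Laplacian (§3, §10) are imported from those of the
Laplacian.

## What this file proves (everything; no named fact is introduced)

* `resolventZd d m² x y`, `fracResolventFourier d β m² x y` — the kernels (2.12), (2.13) as real
  Fourier integrals over the tree's Brillouin zone `[-π,π]^d` (`cos(k·(x-y))` form, the symbol
  `λ` = `laplaceSymbol` being even; same convention as `fracLaplacianZd`).
* **`Slade2017_prop213`** — Proposition 2.1.3 in the massive case `m² > 0`, `β ∈ (0,1)`, for all
  `d` and all pairs of sites: exactly the printed proof, Fubini over `(0,∞) × [-π,π]^d` being
  justified by the integrable majorant `ρ^{(β)}(s,m²)/s` (`Kato.integrableOn_rpow_mul_katoDensity`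
  at exponent `0`) and Kato's formula `Slade2017_lem212` applied at `t = λ(k) ≥ 0`, `a = m²`.
* **`Slade2017_prop213_massless`** — the massless case `m² = 0`, `β ∈ (0, 1 ∧ d/2)`: Kato's
  formula at `t = λ(k) > 0`, `a = 0` off the Lebesgue-null point `k = 0`, and Fubini with the
  majorant `(sin πβ/π)s^{-β}/(s+λ(k))`, whose `s`-integral `λ(k)^{-β}` is integrable on the
  Brillouin zone because `λ(k) ≥ (4/π²)‖k‖²_∞` and `2β < d`
  (`integrableOn_laplaceSymbol_rpow_neg`, from Mathlib's `locallyIntegrable_of_norm_le_rpow` and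
  the tree's `mul_norm_sq_le_dispersion`) — "convergence requires `d > 2β` if `m² = 0`".

Not treated: the display (2.14) `((-Δ)^β+m²)⁻¹𝟙 = m⁻²𝟙` (its row-sum content is proved for the
Neumann-series resolvent `fracResolventZd` in `RigorousRGSmallParameterTorusResolvent.lean`, whose
identification with the Fourier kernel (2.13) is not made here).
-/

noncomputable section

namespace Literature.Barriers.CriticalPhenomena

open _root_.MeasureTheory Set Filter
open scoped _root_.Topology Real

namespace LongRangePhi4

/-! ### Proposition 2.1.3: the resolvent of `(-Δ)^β` as a mixture of Laplacian resolvents -/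

section Prop213

open Literature.Probability.LatticeModels

variable {d : ℕ}

/-- **The resolvent of the lattice Laplacian through its Fourier integral** (Slade (2.12)):
`(-Δ + m²)⁻¹_{x,y} = (2π)^{-d} ∫_{[-π,π]^d} e^{ik·(x-y)}/(λ(k) + m²) dk`; since `λ(-k) = λ(k)` the
printed integral is real and equals the integral of `cos(k·(x-y))/(λ(k)+m²)`, which is what is
written here (same convention as `fracLaplacianZd`). [cite: Slade2017, §2.1.2 (display (2.12))] -/
def resolventZd (d : ℕ) (m2 : ℝ) (x y : Site d) : ℝ :=
  ((2 * π) ^ d)⁻¹ *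
    ∫ k in brillouin d, Real.cos (∑ j, k j * ((x j : ℝ) - (y j : ℝ))) / (laplaceSymbol k + m2)

/-- **The resolvent of the fractional Laplacian through its Fourier integral** (Slade (2.13)):
`((-Δ)^β + m²)⁻¹_{x,y} = (2π)^{-d} ∫_{[-π,π]^d} e^{ik·(x-y)}/(λ(k)^β + m²) dk` (real form with
`cos`). [cite: Slade2017, §2.1.2 (display (2.13))] -/
def fracResolventFourier (d : ℕ) (β m2 : ℝ) (x y : Site d) : ℝ :=
  ((2 * π) ^ d)⁻¹ *
    ∫ k in brillouin d, Real.cos (∑ j, k j * ((x j : ℝ) - (y j : ℝ))) / (laplaceSymbol k ^ β + m2)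

/-- `(-Δ+m²)⁻¹` is a symmetric kernel. [cite: Slade2017, §2.1.2 (display (2.12))] -/
theorem resolventZd_comm (d : ℕ) (m2 : ℝ) (x y : Site d) :
    resolventZd d m2 x y = resolventZd d m2 y x := by
  unfold resolventZd
  congr 1
  refine integral_congr_ae (Eventually.of_forall fun k => ?_)
  simp only
  rw [show (∑ j, k j * ((y j : ℝ) - (x j : ℝ))) = -(∑ j, k j * ((x j : ℝ) - (y j : ℝ))) by
    rw [← Finset.sum_neg_distrib]; exact Finset.sum_congr rfl fun j _ => by ring, Real.cos_neg]

/-- `(-Δ+m²)⁻¹` is translation invariant. [cite: Slade2017, §2.1.2 (display (2.12))] -/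
theorem resolventZd_add (d : ℕ) (m2 : ℝ) (x y v : Site d) :
    resolventZd d m2 (x + v) (y + v) = resolventZd d m2 x y := by
  unfold resolventZd
  congr 1
  refine integral_congr_ae (Eventually.of_forall fun k => ?_)
  simp only [Pi.add_apply, Int.cast_add]
  congr 2
  refine Finset.sum_congr rfl fun j _ => ?_
  ring

/-- `((-Δ)^β+m²)⁻¹` is a symmetric kernel. [cite: Slade2017, §2.1.2 (display (2.13))] -/
theorem fracResolventFourier_comm (d : ℕ) (β m2 : ℝ) (x y : Site d) :
    fracResolventFourier d β m2 x y = fracResolventFourier d β m2 y x := by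
  unfold fracResolventFourier
  congr 1
  refine integral_congr_ae (Eventually.of_forall fun k => ?_)
  simp only
  rw [show (∑ j, k j * ((y j : ℝ) - (x j : ℝ))) = -(∑ j, k j * ((x j : ℝ) - (y j : ℝ))) by
    rw [← Finset.sum_neg_distrib]; exact Finset.sum_congr rfl fun j _ => by ring, Real.cos_neg]

/-- `((-Δ)^β+m²)⁻¹` is translation invariant. [cite: Slade2017, §2.1.2 (display (2.13))] -/
theorem fracResolventFourier_add (d : ℕ) (β m2 : ℝ) (x y v : Site d) :
    fracResolventFourier d β m2 (x + v) (y + v) = fracResolventFourier d β m2 x y := by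
  unfold fracResolventFourier
  congr 1
  refine integral_congr_ae (Eventually.of_forall fun k => ?_)
  simp only [Pi.add_apply, Int.cast_add]
  congr 2
  refine Finset.sum_congr rfl fun j _ => ?_
  ring

/-- The Brillouin zone has finite Lebesgue measure. [folklore] -/
theorem isFiniteMeasure_restrict_brillouin :
    IsFiniteMeasure ((volume : Measure (Fin d → ℝ)).restrict (brillouin d)) :=
  isFiniteMeasure_restrict.2 (isCompact_brillouin d).measure_lt_top.ne

/-- **Slade, Proposition 2.1.3** (massive case). "For `d ≥ 1`, if `m² > 0` and `β ∈ (0,1)` …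
then `((-Δ)^β + m²)⁻¹_{0,x} = ∫₀^∞ (-Δ + s)⁻¹_{0,x} ρ^{(β)}(s,m²) ds`" (display (2.17)), for the
Fourier-integral resolvents (2.12)–(2.13) of `ℤ^d` (any `d`, any sites `x, y` in place of `0, x`).
Printed proof, followed here: "By (2.13) and Lemma 2.1.2, `((-Δ)^β+m²)⁻¹_{0,x} =
(2π)^{-d}∫dk e^{ik·x}∫₀^∞ ds ρ^{(β)}(s,m²)/(λ(k)+s)`. Then we apply Fubini's Theorem and (2.12)" —
Fubini being justified by `|cos| ρ^{(β)}(s,m²)/(λ(k)+s) ≤ ρ^{(β)}(s,m²)/s`, integrable on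
`[-π,π]^d × (0,∞)`. The massless case `m² = 0`, `β < d/2` of the proposition is
`Slade2017_prop213_massless` below.
[cite: Slade2017, Proposition 2.1.3] -/
theorem Slade2017_prop213 {β : ℝ} (hβ0 : 0 < β) (hβ1 : β < 1) {m2 : ℝ} (hm2 : 0 < m2)
    (x y : Site d) :
    fracResolventFourier d β m2 x y =
      ∫ s in Ioi (0 : ℝ), resolventZd d s x y * Kato.katoDensity β m2 s := by
  haveI : IsFiniteMeasure ((volume : Measure (Fin d → ℝ)).restrict (brillouin d)) :=
    isFiniteMeasure_restrict_brillouin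
  set c : (Fin d → ℝ) → ℝ := fun k => Real.cos (∑ j, k j * ((x j : ℝ) - (y j : ℝ))) with hc
  have hcm : Continuous c := by rw [hc]; fun_prop
  have hc1 : ∀ k, |c k| ≤ 1 := fun k => Real.abs_cos_le_one _
  -- the integrand on `(0,∞) × [-π,π]^d`
  set F : ℝ → (Fin d → ℝ) → ℝ := fun s k => c k * (Kato.katoDensity β m2 s / (laplaceSymbol k + s))
    with hF
  have hint : Integrable (Function.uncurry F)
      ((volume.restrict (Ioi (0 : ℝ))).prod ((volume : Measure (Fin d → ℝ)).restrict (brillouin d))) := by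
    have hρ : Integrable (fun s : ℝ => s ^ ((0 : ℝ) - 1) * Kato.katoDensity β m2 s)
        (volume.restrict (Ioi 0)) :=
      Kato.integrableOn_rpow_mul_katoDensity hβ0 hβ1 hm2.ne' (by linarith) hβ0
    have hg := hρ.mul_prod (integrable_const (1 : ℝ) (μ := (volume : Measure (Fin d → ℝ)).restrict (brillouin d)))
    have hlc : Continuous (laplaceSymbol : (Fin d → ℝ) → ℝ) :=
      continuous_const.mul (continuous_dispersion d)
    have hmeas : Measurable (Function.uncurry F) :=
      (hcm.measurable.comp measurable_snd).mul (((Kato.measurable_katoDensity β m2).comp measurable_fst).div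
        ((hlc.measurable.comp measurable_snd).add measurable_fst))
    refine hg.mono' hmeas.aestronglyMeasurable ?_
    rw [Measure.prod_restrict]
    refine (ae_restrict_iff' (measurableSet_Ioi.prod (measurableSet_brillouin d))).2
      (Eventually.of_forall fun p hp => ?_)
    obtain ⟨s, k⟩ := p
    have hs : 0 < s := hp.1
    have hρs : 0 ≤ Kato.katoDensity β m2 s := (Kato.katoDensity_pos hβ0 hβ1 m2 hs).le
    have hlam : 0 ≤ laplaceSymbol k := laplaceSymbol_nonneg k
    simp only [Function.uncurry_apply_pair, hF, zero_sub, Real.rpow_neg_one, mul_one]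
    rw [Real.norm_eq_abs, abs_mul, abs_of_nonneg (div_nonneg hρs (by positivity))]
    calc |c k| * (Kato.katoDensity β m2 s / (laplaceSymbol k + s))
        ≤ 1 * (Kato.katoDensity β m2 s / s) := by
          gcongr
          · exact hc1 k
          · linarith
      _ = s⁻¹ * Kato.katoDensity β m2 s := by ring
  -- right-hand side as an iterated integral
  have hR : ∀ s : ℝ, resolventZd d s x y * Kato.katoDensity β m2 s =
      ((2 * π) ^ d)⁻¹ * ∫ k in brillouin d, F s k := by
    intro s
    rw [resolventZd, mul_assoc, ← integral_mul_const]
    congr 1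
    refine setIntegral_congr_fun (measurableSet_brillouin d) fun k _ => ?_
    simp only [hF, hc]
    ring
  simp_rw [hR]
  rw [integral_const_mul, integral_integral_swap hint, fracResolventFourier]
  congr 1
  refine setIntegral_congr_fun (measurableSet_brillouin d) fun k _ => ?_
  -- the inner `s`-integral is Kato's formula at `t = λ(k)`, `a = m²`
  have hlam : 0 ≤ laplaceSymbol k := laplaceSymbol_nonneg k
  have hK := Slade2017_lem212 hβ0 hβ1 hlam hm2.le (Or.inr hm2)
  simp only [hF]
  rw [integral_const_mul, div_eq_mul_one_div (c k), hK]
  congr 1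
  refine setIntegral_congr_fun measurableSet_Ioi fun s _ => ?_
  rw [add_comm (laplaceSymbol k) s]


/-! #### The massless case `m² = 0`, `β < d/2` -/

/-- **`λ(k)^{-β}` is integrable on the Brillouin zone when `2β < d`**: `λ(k) ≥ (4/π²)‖k‖²_∞`, so
`λ^{-β} = O(‖k‖^{-2β})`, locally integrable in dimension `d > 2β`
(Mathlib `locallyIntegrable_of_norm_le_rpow`). [cite: Slade2017, §2.1.2 ("convergence requires d > 2β if m² = 0")] -/
theorem integrableOn_laplaceSymbol_rpow_neg {β : ℝ} (hβ0 : 0 < β) (hβd : 2 * β < d) :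
    IntegrableOn (fun k : Fin d → ℝ => laplaceSymbol k ^ (-β)) (brillouin d) := by
  have hd : 1 ≤ d := by
    by_contra h
    push Not at h
    interval_cases d
    simp at hβd
    linarith
  set g : (Fin d → ℝ) → ℝ := fun k => laplaceSymbol k ^ (-β) with hg
  set f := (brillouin d).indicator g with hf
  have hlc : Continuous (laplaceSymbol : (Fin d → ℝ) → ℝ) :=
    continuous_const.mul (continuous_dispersion d)
  have hmeas : AEStronglyMeasurable f volume :=
    (Measurable.indicator (hlc.measurable.pow_const _) (measurableSet_brillouin d)).aestronglyMeasurable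
  have hC0 : 0 < (4 / π ^ 2 : ℝ) := by positivity
  have hdecay : ∀ p, ‖f p‖ ≤ (4 / π ^ 2) ^ (-β) * ‖p‖ ^ (-(2 * β)) := by
    intro p
    have hnn : 0 ≤ (4 / π ^ 2 : ℝ) ^ (-β) * ‖p‖ ^ (-(2 * β)) :=
      mul_nonneg (Real.rpow_nonneg hC0.le _) (Real.rpow_nonneg (norm_nonneg _) _)
    by_cases hp : p ∈ brillouin d
    · rcases eq_or_ne p 0 with rfl | hp0
      · have h0 : f 0 = 0 := by
          simp [hf, hg, laplaceSymbol, dispersion, Real.zero_rpow (neg_ne_zero.2 hβ0.ne')]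
        rw [h0, norm_zero]
        exact hnn
      · have hpos : 0 < ‖p‖ := norm_pos_iff.2 hp0
        have hε : 2 / π ^ 2 * ‖p‖ ^ 2 ≤ dispersion p := mul_norm_sq_le_dispersion hp
        have hlam2 : 4 / π ^ 2 * ‖p‖ ^ 2 ≤ laplaceSymbol p := by
          have h2 : (4 / π ^ 2 * ‖p‖ ^ 2 : ℝ) = 2 * (2 / π ^ 2 * ‖p‖ ^ 2) := by ring
          rw [h2]
          exact mul_le_mul_of_nonneg_left hε (by norm_num)
        have hlampos : 0 < laplaceSymbol p := lt_of_lt_of_le (by positivity) hlam2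
        rw [hf, Set.indicator_of_mem hp, hg, Real.norm_eq_abs,
          abs_of_nonneg (Real.rpow_nonneg hlampos.le _)]
        calc laplaceSymbol p ^ (-β) ≤ (4 / π ^ 2 * ‖p‖ ^ 2) ^ (-β) :=
            Real.rpow_le_rpow_of_nonpos (by positivity) hlam2 (by linarith)
          _ = (4 / π ^ 2) ^ (-β) * ‖p‖ ^ (-(2 * β)) := by
            rw [Real.mul_rpow hC0.le (by positivity), show (‖p‖ ^ 2 : ℝ) = ‖p‖ ^ (2 : ℝ) by
              rw [Real.rpow_two], ← Real.rpow_mul (norm_nonneg _)]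
            ring_nf
    · rw [hf, Set.indicator_of_notMem hp, norm_zero]
      exact hnn
  have hrank : Module.finrank ℝ (Fin d → ℝ) = d := Module.finrank_fin_fun ℝ
  have hloc : LocallyIntegrable f volume :=
    locallyIntegrable_of_norm_le_rpow (by rw [hrank]; exact hd)
      (by rw [hrank]; exact hβd) (Eventually.of_forall hdecay) hmeas
  have hK : IntegrableOn f (brillouin d) volume := hloc.integrableOn_isCompact (isCompact_brillouin d)
  exact (integrableOn_congr_fun (Set.eqOn_indicator (s := brillouin d) (f := g))
    (measurableSet_brillouin d)).1 hK

/-- `λ(k) > 0` on `[-π,π]^d ∖ {0}`. [cite: Slade2017, §2.1.1] -/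
theorem laplaceSymbol_pos_of_mem_brillouin {k : Fin d → ℝ} (hk : k ∈ brillouin d) (hk0 : k ≠ 0) :
    0 < laplaceSymbol k :=
  mul_pos two_pos (dispersion_pos_of_mem_brillouin hk hk0)

/-- Kato's density at `a = 0`: `ρ^{(β)}(s,0)/(λ+s) = (sin πβ/π) s^{(1-β)-1}/(s+λ)`. [folklore] -/
theorem katoDensity_zero_div (β : ℝ) {s : ℝ} (hs : 0 < s) (l : ℝ) :
    Kato.katoDensity β 0 s / (l + s) = Real.sin (π * β) / π * (s ^ ((1 - β) - 1) / (s + l)) := by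
  unfold Kato.katoDensity
  have h2 : s ^ (2 * β) = s ^ β * s ^ β := by rw [two_mul, Real.rpow_add hs]
  have hsb : 0 < s ^ β := Real.rpow_pos_of_pos hs _
  rw [h2, show (1 - β) - 1 = -β by ring, Real.rpow_neg hs.le, add_comm l s]
  field_simp
  ring

/-- **Slade, Proposition 2.1.3, massless case**: "if `m² = 0` and `β ∈ (0, 1 ∧ d/2)`, then
`((-Δ)^β)⁻¹_{0,x} = ∫₀^∞ (-Δ+s)⁻¹_{0,x} ρ^{(β)}(s,0) ds`" (display (2.17) at `m² = 0`), for the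
Fourier-integral kernels (2.12)–(2.13). Same printed proof: Kato's formula at `t = λ(k) > 0`,
`a = 0` (for `k ≠ 0`, a Lebesgue-null exception), then Fubini, now justified by the majorant
`(sin πβ/π) s^{-β}/(s+λ(k))` whose `s`-integral `λ(k)^{-β}` is `k`-integrable for `2β < d`.
[cite: Slade2017, Proposition 2.1.3] -/
theorem Slade2017_prop213_massless {β : ℝ} (hβ0 : 0 < β) (hβ1 : β < 1) (hβd : 2 * β < d)
    (x y : Site d) :
    fracResolventFourier d β 0 x y =
      ∫ s in Ioi (0 : ℝ), resolventZd d s x y * Kato.katoDensity β 0 s := by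
  have hd : 1 ≤ d := by
    by_contra h
    push Not at h
    interval_cases d
    simp at hβd
    linarith
  haveI : Nonempty (Fin d) := ⟨⟨0, hd⟩⟩
  haveI : IsFiniteMeasure ((volume : Measure (Fin d → ℝ)).restrict (brillouin d)) :=
    isFiniteMeasure_restrict_brillouin
  have hsin : 0 < Real.sin (π * β) := Real.sin_pos_of_pos_of_lt_pi (by positivity)
    (by nlinarith [Real.pi_pos])
  set c : (Fin d → ℝ) → ℝ := fun k => Real.cos (∑ j, k j * ((x j : ℝ) - (y j : ℝ))) with hc
  have hcm : Continuous c := by rw [hc]; fun_prop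
  have hc1 : ∀ k, |c k| ≤ 1 := fun k => Real.abs_cos_le_one _
  have hlc : Continuous (laplaceSymbol : (Fin d → ℝ) → ℝ) :=
    continuous_const.mul (continuous_dispersion d)
  -- `k = 0` is negligible
  have hae0 : ∀ᵐ k ∂((volume : Measure (Fin d → ℝ)).restrict (brillouin d)),
      k ∈ brillouin d ∧ k ≠ 0 := by
    have h0 : ∀ᵐ k ∂((volume : Measure (Fin d → ℝ)).restrict (brillouin d)), k ≠ (0 : Fin d → ℝ) := by
      refine ae_restrict_of_ae ?_
      rw [ae_iff]
      simp only [ne_eq, Decidable.not_not, setOf_eq_eq_singleton]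
      exact measure_singleton 0
    filter_upwards [ae_restrict_mem (measurableSet_brillouin d), h0] with k hk hk0
    exact ⟨hk, hk0⟩
  -- the `s`-integral of the majorant and Kato's formula, for `k ≠ 0`
  have hinner : ∀ k ∈ brillouin d, k ≠ 0 →
      IntegrableOn (fun s : ℝ => Kato.katoDensity β 0 s / (laplaceSymbol k + s)) (Ioi 0) ∧
      ∫ s in Ioi (0 : ℝ), Kato.katoDensity β 0 s / (laplaceSymbol k + s) = laplaceSymbol k ^ (-β) := by
    intro k hk hk0
    have hlam : 0 < laplaceSymbol k := laplaceSymbol_pos_of_mem_brillouin hk hk0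
    have hK := Slade2017_lem212 hβ0 hβ1 hlam.le le_rfl (Or.inl hlam)
    rw [add_zero, one_div, ← Real.rpow_neg_one, ← Real.rpow_mul hlam.le, mul_neg_one] at hK
    refine ⟨?_, ?_⟩
    · have h := (Kato.integrableOn_rpow_div_add (σ := 1 - β) (by linarith) (by linarith) hlam).const_mul
        (Real.sin (π * β) / π)
      refine h.congr ((ae_restrict_iff' measurableSet_Ioi).2 (Eventually.of_forall fun s hs => ?_))
      exact (katoDensity_zero_div β hs _).symm
    · rw [hK]
      exact setIntegral_congr_fun measurableSet_Ioi fun s _ => by rw [add_comm (laplaceSymbol k) s]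
  -- the integrand on `(0,∞) × [-π,π]^d`
  set F : ℝ → (Fin d → ℝ) → ℝ := fun s k => c k * (Kato.katoDensity β 0 s / (laplaceSymbol k + s))
    with hF
  have hmeas : Measurable (Function.uncurry F) :=
    (hcm.measurable.comp measurable_snd).mul (((Kato.measurable_katoDensity β 0).comp measurable_fst).div
      ((hlc.measurable.comp measurable_snd).add measurable_fst))
  have hint : Integrable (Function.uncurry F)
      ((volume.restrict (Ioi (0 : ℝ))).prod ((volume : Measure (Fin d → ℝ)).restrict (brillouin d))) := by
    refine (integrable_prod_iff' hmeas.aestronglyMeasurable).2 ⟨?_, ?_⟩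
    · filter_upwards [hae0] with k hk
      have h := (hinner k hk.1 hk.2).1.const_mul (c k)
      exact h.congr (Eventually.of_forall fun s => by simp [hF])
    · -- `k ↦ ∫‖F(s,k)‖ds = |c k| λ(k)^{-β} ≤ λ(k)^{-β}`
      have hI := integrableOn_laplaceSymbol_rpow_neg hβ0 hβd
      refine hI.mono' (hmeas.stronglyMeasurable.norm.integral_prod_left').aestronglyMeasurable ?_
      filter_upwards [hae0] with k hk
      have hlam : 0 < laplaceSymbol k := laplaceSymbol_pos_of_mem_brillouin hk.1 hk.2
      have hnorm : ∀ s ∈ Ioi (0 : ℝ), ‖Function.uncurry F (s, k)‖ =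
          |c k| * (Kato.katoDensity β 0 s / (laplaceSymbol k + s)) := by
        intro s hs
        have hs : 0 < s := hs
        simp only [Function.uncurry_apply_pair, hF]
        rw [Real.norm_eq_abs, abs_mul, abs_of_nonneg (div_nonneg (Kato.katoDensity_pos hβ0 hβ1 0 hs).le
          (by positivity))]
      rw [Real.norm_eq_abs, abs_of_nonneg (integral_nonneg fun s => norm_nonneg _),
        setIntegral_congr_fun measurableSet_Ioi hnorm, integral_const_mul, (hinner k hk.1 hk.2).2]
      calc |c k| * laplaceSymbol k ^ (-β) ≤ 1 * laplaceSymbol k ^ (-β) :=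
            mul_le_mul_of_nonneg_right (hc1 k) (Real.rpow_nonneg hlam.le _)
        _ = laplaceSymbol k ^ (-β) := one_mul _
  -- right-hand side as an iterated integral
  have hR : ∀ s : ℝ, resolventZd d s x y * Kato.katoDensity β 0 s =
      ((2 * π) ^ d)⁻¹ * ∫ k in brillouin d, F s k := by
    intro s
    rw [resolventZd, mul_assoc, ← integral_mul_const]
    congr 1
    refine setIntegral_congr_fun (measurableSet_brillouin d) fun k _ => ?_
    simp only [hF, hc]
    ring
  simp_rw [hR]
  rw [integral_const_mul, integral_integral_swap hint, fracResolventFourier]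
  congr 1
  refine integral_congr_ae ?_
  filter_upwards [hae0] with k hk
  have hlam : 0 < laplaceSymbol k := laplaceSymbol_pos_of_mem_brillouin hk.1 hk.2
  simp only [hF]
  rw [integral_const_mul, (hinner k hk.1 hk.2).2, add_zero, Real.rpow_neg hlam.le, div_eq_mul_inv]

end Prop213

end LongRangePhi4

end Literature.Barriers.CriticalPhenomena
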